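import Summits.RiemannHypothesis.RiemannHypothesis.Theorems.TiltedLandingLaw421R3BudgetRect

/-!
# K-2 budget, the cell cover — the TAIL cell and the bundled rectangle data (C1 g36, W-08 ⟨33346⟩)

Continuation of `…R3BudgetRect`:
* `cellAt_of_tail` — the unbounded cell `Im z ≥ β_T·Im v` (`β_T > 1`), `|δ| ≤ 1+β`, carries `β`-free cell constants
  (`S₀ ≤ (β_T−1)²/(β_T²+1)`, `T₁ ≥ 3 + 2β_T/(β_T−1)`, `R₁ ≥ 1/(β_T−1)+1/(β_T+1)`, `I₁ ≥ max(1/2, 2/(β_T−1))`, `r₁² ≥ 2+2/β_T²`);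
* `RectData` — the 21 closed rational side conditions of the rectangle lemma bundled into ONE decidable predicate, and
  `cellAt_of_rectData` — the rectangle lemma in the form the generated table uses (one `norm_num [RectData, CellOK]` per leaf).
Support-level, claim-free.  Nothing here bears on the truth of RH; RH is not proved; `TiltedLandingLaw421R` and ⟨33346⟩/⟨33347⟩ OPEN.
-/

noncomputable section

open Complex
open scoped ComplexConjugate
open RhW08.UncoveredSign (pairPull)
open RhW08.PairSign (pairPull_eq leading_ge_three_of_touch)
open RhW08.BudgetAlgebra (pairExplicit re_im_pairExplicit_sub)
open RhW08.BudgetBox (CellOK CellAt CellCover)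

namespace RhW08.BudgetRect

/-! ## §5 The tail cell `Im z ≥ β_T·Im v` -/

/-- (real algebra) `β_T a ≤ b`, `0 < a`, `1 < β_T` ⇒ `(β_T−1)²/(β_T²+1) ≤ (b−a)²/(a²+b²)`
(`f(β) = (β−1)²/(β²+1)` increases on `β > 1`; `(b−a)²(β_T²+1) − (β_T−1)²(a²+b²) = 2(β_T b − a)(b − β_T a)`). -/
theorem tail_s_real {a b βT : ℝ} (ha : 0 < a) (hβT : 1 < βT) (hbT : βT * a ≤ b) :
    (βT - 1) ^ 2 / (βT ^ 2 + 1) ≤ (b - a) ^ 2 / (a ^ 2 + b ^ 2) := by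
  have hba : a ≤ b := by nlinarith [mul_nonneg (sub_nonneg.mpr hβT.le) ha.le]
  have h1 : 0 ≤ βT * b - a := by nlinarith [mul_nonneg (sub_nonneg.mpr hβT.le) (ha.le.trans hba)]
  have h2 : 0 ≤ b - βT * a := by linarith
  rw [div_le_div_iff₀ (by positivity) (by positivity)]
  nlinarith [mul_nonneg h1 h2]

/-- §5(S) tail: `S₀ ≤ (β_T−1)²/(β_T²+1)` ⇒ `S₀ ≤ T_v + T_z − 3` (touching pair with `Im z ≥ β_T Im v`). -/
theorem tail_s_ge {v z : ℂ} {βT S₀ : ℝ}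
    (hv : 0 < v.im) (hvz : v.im < z.im) (ht : |v.re - z.re| ≤ v.im + z.im)
    (hβT : 1 < βT) (hbT : βT * v.im ≤ z.im) (hS : S₀ ≤ (βT - 1) ^ 2 / (βT ^ 2 + 1)) :
    S₀ ≤ (1 - 2 * v.im * pairPull v z) + (1 - 2 * z.im * pairPull z v) - 3 := by
  rw [s_eq]
  set a := v.im with ha
  set b := z.im with hb
  set x := z.re - v.re with hx
  have hba0 : 0 < b - a := by linarith
  have hbp0 : 0 < b + a := by linarith
  have hP0 : 0 < x ^ 2 + (b - a) ^ 2 := by positivity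
  have hQ0 : 0 < x ^ 2 + (b + a) ^ 2 := by positivity
  have hx2 : x ^ 2 ≤ (b + a) ^ 2 := by
    have h1 : |x| ≤ b + a := by rw [hx, abs_sub_comm]; linarith
    calc x ^ 2 = |x| ^ 2 := (sq_abs x).symm
      _ ≤ (b + a) ^ 2 := pow_le_pow_left₀ (abs_nonneg x) h1 2
  have hPu : x ^ 2 + (b - a) ^ 2 ≤ 2 * a ^ 2 + 2 * b ^ 2 := by linarith [hx2]
  have hQu : x ^ 2 + (b + a) ^ 2 ≤ 2 * (b + a) ^ 2 := by linarith
  have g1 : 2 * (b - a) ^ 2 / (2 * a ^ 2 + 2 * b ^ 2) ≤ 2 * (b - a) ^ 2 / (x ^ 2 + (b - a) ^ 2) :=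
    div_le_div_of_nonneg_left (by positivity) hP0 hPu
  have g2 : 2 * (b + a) ^ 2 / (2 * (b + a) ^ 2) ≤ 2 * (b + a) ^ 2 / (x ^ 2 + (b + a) ^ 2) :=
    div_le_div_of_nonneg_left (by positivity) hQ0 hQu
  have e2 : 2 * (b + a) ^ 2 / (2 * (b + a) ^ 2) = 1 := div_self (by positivity)
  have e1 : 2 * (b - a) ^ 2 / (2 * a ^ 2 + 2 * b ^ 2) = (b - a) ^ 2 / (a ^ 2 + b ^ 2) := by
    rw [show 2 * a ^ 2 + 2 * b ^ 2 = 2 * (a ^ 2 + b ^ 2) by ring, mul_div_mul_left _ _ two_ne_zero]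
  have k := tail_s_real hv hβT hbT
  rw [← e1] at k
  linarith

/-- §5(T) tail: `Im z ≥ β_T Im v` ⇒ `T_z ≤ 3 + 2β_T/(β_T−1)` (`2b(b−a)/P ≤ 2b/(b−a)`, `2b(b+a)/Q ≤ 2`). -/
theorem tail_tz_le {v z : ℂ} {βT T₁ : ℝ}
    (hv : 0 < v.im) (hvz : v.im < z.im) (hβT : 1 < βT) (hbT : βT * v.im ≤ z.im)
    (hT : 3 + 2 * βT / (βT - 1) ≤ T₁) : 1 - 2 * z.im * pairPull z v ≤ T₁ := by
  rw [tz_eq]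
  set a := v.im with ha
  set b := z.im with hb
  set x := z.re - v.re with hx
  have hba0 : 0 < b - a := by linarith
  have hbp0 : 0 < b + a := by linarith
  have hb0 : 0 < b := by linarith
  have hP0 : 0 < x ^ 2 + (b - a) ^ 2 := by positivity
  have hQ0 : 0 < x ^ 2 + (b + a) ^ 2 := by positivity
  have hPl : (b - a) ^ 2 ≤ x ^ 2 + (b - a) ^ 2 := by linarith [sq_nonneg x]
  have hQl : (b + a) ^ 2 ≤ x ^ 2 + (b + a) ^ 2 := by linarith [sq_nonneg x]
  have g1 : 2 * b * (b - a) / (x ^ 2 + (b - a) ^ 2) ≤ 2 * b * (b - a) / (b - a) ^ 2 :=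
    div_le_div_of_nonneg_left (mul_nonneg (by positivity) hba0.le) (pow_pos hba0 2) hPl
  have g2 : 2 * b * (b + a) / (x ^ 2 + (b + a) ^ 2) ≤ 2 * b * (b + a) / (b + a) ^ 2 :=
    div_le_div_of_nonneg_left (mul_nonneg (by positivity) hbp0.le) (pow_pos hbp0 2) hQl
  have e1 : 2 * b * (b - a) / (b - a) ^ 2 = 2 * b / (b - a) := by
    field_simp
  have e2 : 2 * b * (b + a) / (b + a) ^ 2 = 2 * b / (b + a) := by
    field_simp
  have k1 : 2 * b / (b - a) ≤ 2 * βT / (βT - 1) := by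
    rw [div_le_div_iff₀ hba0 (by linarith)]; linarith
  have k2 : 2 * b / (b + a) ≤ 2 := by
    rw [div_le_iff₀ hbp0]; linarith
  rw [e1] at g1
  rw [e2] at g2
  linarith

/-- §5(E) tail: `Im z ≥ β_T Im v` ⇒ `Im v·‖E_z − E_v‖ ≤ e₁` for `R₁ ≥ 1/(β_T−1) + 1/(β_T+1)`,
`I₁ ≥ max(1/2, 2/(β_T−1))`, `R₁²+I₁² ≤ e₁²` (`2a|x|/P ≤ a/(b−a)`, `2a|x|/Q ≤ a/(b+a)`; `0 ≤ 1/2 − a/2b`, `2a(b−a)/P ≤ 2a/(b−a)`). -/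
theorem tail_e_le {v z : ℂ} {βT R₁ I₁ e₁ : ℝ}
    (hv : 0 < v.im) (hvz : v.im < z.im) (hβT : 1 < βT) (hbT : βT * v.im ≤ z.im)
    (hR : 1 / (βT - 1) + 1 / (βT + 1) ≤ R₁) (hI : max (1 / 2) (2 / (βT - 1)) ≤ I₁)
    (he0 : 0 ≤ e₁) (he : R₁ ^ 2 + I₁ ^ 2 ≤ e₁ ^ 2) :
    v.im * ‖pairExplicit z v - pairExplicit v z‖ ≤ e₁ := by
  have hb : 0 < z.im := hv.trans hvz
  have hne : v ≠ z := fun h => by rw [h] at hvz; exact lt_irrefl _ hvz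
  obtain ⟨hre, him⟩ := re_im_pairExplicit_sub hv hb hne
  obtain ⟨-, hN1, hN2⟩ := coords v z
  rw [hN1, hN2] at hre
  rw [hN1] at him
  set E := pairExplicit z v - pairExplicit v z with hE
  set a := v.im with ha
  set b := z.im with hb'
  set x := z.re - v.re with hx
  have ha0 : a ≠ 0 := hv.ne'
  have hba0 : 0 < b - a := by linarith
  have hbp0 : 0 < b + a := by linarith
  have hP0 : 0 < x ^ 2 + (b - a) ^ 2 := by positivity
  have hQ0 : 0 < x ^ 2 + (b + a) ^ 2 := by positivity
  have hI1 : 1 / 2 ≤ I₁ := (le_max_left _ _).trans hI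
  have hI2 : 2 / (βT - 1) ≤ I₁ := (le_max_right _ _).trans hI
  have hβa : (βT - 1) * a ≤ b - a := by linarith
  have hβa' : (βT + 1) * a ≤ b + a := by linarith
  -- real part
  have hc0 : 0 ≤ 2 * a / (x ^ 2 + (b - a) ^ 2) + 2 * a / (x ^ 2 + (b + a) ^ 2) := by positivity
  have hre' : a * E.re = (2 * a / (x ^ 2 + (b - a) ^ 2) + 2 * a / (x ^ 2 + (b + a) ^ 2)) * x := by
    rw [hre]; ring
  have k1 : 2 * |x| * (b - a) ≤ x ^ 2 + (b - a) ^ 2 := by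
    linarith [sq_nonneg (|x| - (b - a)), sq_abs x]
  have k2 : 2 * |x| * (b + a) ≤ x ^ 2 + (b + a) ^ 2 := by
    linarith [sq_nonneg (|x| - (b + a)), sq_abs x]
  have g1 : 2 * a * |x| / (x ^ 2 + (b - a) ^ 2) ≤ a / (b - a) := by
    rw [div_le_div_iff₀ hP0 hba0]
    have := mul_le_mul_of_nonneg_left k1 hv.le
    linarith
  have g2 : 2 * a * |x| / (x ^ 2 + (b + a) ^ 2) ≤ a / (b + a) := by
    rw [div_le_div_iff₀ hQ0 hbp0]
    have := mul_le_mul_of_nonneg_left k2 hv.le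
    linarith
  have g1' : a / (b - a) ≤ 1 / (βT - 1) := by
    rw [div_le_div_iff₀ hba0 (by linarith)]; linarith
  have g2' : a / (b + a) ≤ 1 / (βT + 1) := by
    rw [div_le_div_iff₀ hbp0 (by linarith)]; linarith
  have hcap : (2 * a / (x ^ 2 + (b - a) ^ 2) + 2 * a / (x ^ 2 + (b + a) ^ 2)) * |x| ≤ R₁ := by
    have e : (2 * a / (x ^ 2 + (b - a) ^ 2) + 2 * a / (x ^ 2 + (b + a) ^ 2)) * |x| =
        2 * a * |x| / (x ^ 2 + (b - a) ^ 2) + 2 * a * |x| / (x ^ 2 + (b + a) ^ 2) := by ring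
    rw [e]; linarith
  have hReu : a * E.re ≤ R₁ := by
    rw [hre']; exact (mul_le_mul_of_nonneg_left (le_abs_self x) hc0).trans hcap
  have hRel : -R₁ ≤ a * E.re := by
    rw [hre']
    have := mul_le_mul_of_nonneg_left (neg_abs_le x) hc0
    linarith
  -- imaginary part
  have him' : a * E.im = 1 / 2 - a / (2 * b) - 2 * a * (b - a) / (x ^ 2 + (b - a) ^ 2) := by
    rw [him]; field_simp
  have q1 : 0 ≤ a / (2 * b) := by positivity
  have q2 : a / (2 * b) ≤ 1 / 2 := by
    rw [div_le_iff₀ (by linarith)]; linarith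
  have q3 : 0 ≤ 2 * a * (b - a) / (x ^ 2 + (b - a) ^ 2) :=
    div_nonneg (mul_nonneg (by positivity) hba0.le) hP0.le
  have q4 : 2 * a * (b - a) / (x ^ 2 + (b - a) ^ 2) ≤ 2 / (βT - 1) := by
    have hPl : (b - a) ^ 2 ≤ x ^ 2 + (b - a) ^ 2 := by linarith [sq_nonneg x]
    have s1 : 2 * a * (b - a) / (x ^ 2 + (b - a) ^ 2) ≤ 2 * a * (b - a) / (b - a) ^ 2 :=
      div_le_div_of_nonneg_left (mul_nonneg (by positivity) hba0.le) (pow_pos hba0 2) hPl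
    have s2 : 2 * a * (b - a) / (b - a) ^ 2 = 2 * a / (b - a) := by field_simp
    have s3 : 2 * a / (b - a) ≤ 2 / (βT - 1) := by
      rw [div_le_div_iff₀ hba0 (by linarith)]; linarith
    rw [s2] at s1
    linarith
  have hImu : a * E.im ≤ I₁ := by rw [him']; linarith
  have hIml : -I₁ ≤ a * E.im := by rw [him']; linarith
  -- squares and the norm
  have s1 : (a * E.re) ^ 2 ≤ R₁ ^ 2 := sq_le_sq' hRel hReu
  have s2 : (a * E.im) ^ 2 ≤ I₁ ^ 2 := sq_le_sq' hIml hImu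
  have hn : (a * ‖E‖) ^ 2 = (a * E.re) ^ 2 + (a * E.im) ^ 2 := by
    rw [mul_pow, ← Complex.normSq_eq_norm_sq, Complex.normSq_apply]; ring
  have hsq : (a * ‖E‖) ^ 2 ≤ e₁ ^ 2 := by rw [hn]; linarith
  exact (pow_le_pow_iff_left₀ (by positivity) he0 two_ne_zero).mp hsq

/-- §5(r) tail: `Im z ≥ β_T Im v`, touching ⇒ `‖z − v‖ ≤ r₁·Im z` for `r₁² ≥ 2 + 2/β_T²`, `r₁ ≥ 0`
(`‖z−v‖² = x² + (b−a)² ≤ 2a² + 2b²`, `a ≤ b/β_T`). -/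
theorem tail_r_le {v z : ℂ} {βT r₁ : ℝ}
    (hv : 0 < v.im) (hvz : v.im < z.im) (ht : |v.re - z.re| ≤ v.im + z.im)
    (hβT : 1 < βT) (hbT : βT * v.im ≤ z.im) (hr0 : 0 ≤ r₁) (hr : 2 + 2 / βT ^ 2 ≤ r₁ ^ 2) :
    ‖z - v‖ ≤ r₁ * z.im := by
  obtain ⟨hn, -, -⟩ := coords v z
  set a := v.im with ha
  set b := z.im with hb
  set x := z.re - v.re with hx
  have hb0 : 0 < b := by linarith
  have hβ0 : 0 < βT := by linarith
  have hx2 : x ^ 2 ≤ (b + a) ^ 2 := by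
    have h1 : |x| ≤ b + a := by rw [hx, abs_sub_comm]; linarith
    calc x ^ 2 = |x| ^ 2 := (sq_abs x).symm
      _ ≤ (b + a) ^ 2 := pow_le_pow_left₀ (abs_nonneg x) h1 2
  have hsq : (βT * a) ^ 2 ≤ b ^ 2 := pow_le_pow_left₀ (by positivity) hbT 2
  have e : 2 * a ^ 2 = 2 / βT ^ 2 * (βT * a) ^ 2 := by field_simp
  have h2a : 2 * a ^ 2 ≤ 2 / βT ^ 2 * b ^ 2 := by
    rw [e]; exact mul_le_mul_of_nonneg_left hsq (by positivity)
  have h1 : ‖z - v‖ ^ 2 ≤ (r₁ * b) ^ 2 := by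
    rw [hn]
    calc x ^ 2 + (b - a) ^ 2 ≤ 2 * a ^ 2 + 2 * b ^ 2 := by linarith [hx2]
      _ ≤ 2 / βT ^ 2 * b ^ 2 + 2 * b ^ 2 := by linarith
      _ = (2 + 2 / βT ^ 2) * b ^ 2 := by ring
      _ ≤ r₁ ^ 2 * b ^ 2 := mul_le_mul_of_nonneg_right hr (sq_nonneg b)
      _ = (r₁ * b) ^ 2 := by ring
  exact (pow_le_pow_iff_left₀ (norm_nonneg _) (by positivity) two_ne_zero).mp h1

/-- ★ §5 THE TAIL CELL: a separated touching pair with `Im z ≥ β_T·Im v` (`β_T > 1`) satisfies `CellAt μ₀ v z`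
with the `β`-free constants `S₀ ≤ (β_T−1)²/(β_T²+1)`, `T₁ ≥ 3 + 2β_T/(β_T−1)`, `R₁ ≥ 1/(β_T−1)+1/(β_T+1)`,
`I₁ ≥ max(1/2, 2/(β_T−1))`, `r₁² ≥ 2 + 2/β_T²`, `β₀ := β_T`, once `CellOK S₀ T₁ (e₁+μ₀r₁) β_T μ₀`. -/
theorem cellAt_of_tail {v z : ℂ} {μ₀ βT S₀ T₁ R₁ I₁ e₁ r₁ : ℝ}
    (hv : 0 < v.im) (hvz : v.im < z.im) (ht : |v.re - z.re| ≤ v.im + z.im)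
    (hβT : 1 < βT) (hbT : βT * v.im ≤ z.im)
    (hS0 : 0 ≤ S₀) (hS : S₀ ≤ (βT - 1) ^ 2 / (βT ^ 2 + 1))
    (hT : 3 + 2 * βT / (βT - 1) ≤ T₁) (hT10 : T₁ ≤ 10)
    (hR : 1 / (βT - 1) + 1 / (βT + 1) ≤ R₁) (hI : max (1 / 2) (2 / (βT - 1)) ≤ I₁)
    (he0 : 0 ≤ e₁) (he : R₁ ^ 2 + I₁ ^ 2 ≤ e₁ ^ 2) (hr0 : 0 ≤ r₁) (hr : 2 + 2 / βT ^ 2 ≤ r₁ ^ 2)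
    (hPlo : 2 / 3 ≤ e₁ + μ₀ * r₁) (hPhi : e₁ + μ₀ * r₁ ≤ 13 / 2)
    (hOK : CellOK S₀ T₁ (e₁ + μ₀ * r₁) βT μ₀) : CellAt μ₀ v z :=
  ⟨S₀, T₁, e₁, r₁, βT, hS0, tail_s_ge hv hvz ht hβT hbT hS, tail_tz_le hv hvz hβT hbT hT, hT10,
    tail_e_le hv hvz hβT hbT hR hI he0 he, tail_r_le hv hvz ht hβT hbT hr0 hr, hβT.le, hbT,
    hPlo, hPhi, hOK⟩

/-! ## §6 The bundled rectangle data (table form of `cellAt_of_rect`) -/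

/-- §6 RECTANGLE DATA: the 21 closed side conditions of `cellAt_of_rect` on the rational cell data
`β₁ β₂ d₁ d₂ N₁ₗ N₁ᵤ N₂ₗ S₀ T₁ R₁ I₁ e₁ r₁` (and `μ₀`), as one predicate decidable by `norm_num [RectData, CellOK]`. -/
def RectData (μ₀ β₁ β₂ d₁ d₂ N₁ₗ N₁ᵤ N₂ₗ S₀ T₁ R₁ I₁ e₁ r₁ : ℝ) : Prop :=
  1 ≤ β₁ ∧ 0 ≤ d₁ ∧ N₁ₗ ≤ max (d₁ ^ 2 + (β₁ - 1) ^ 2) (1 / 4) ∧ 0 < N₁ₗ ∧ d₂ ^ 2 + (β₂ - 1) ^ 2 ≤ N₁ᵤ ∧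
    N₂ₗ ≤ d₁ ^ 2 + (β₁ + 1) ^ 2 ∧ 0 < N₂ₗ ∧ 0 ≤ S₀ ∧
    S₀ ≤ max 0 (2 * (β₁ - 1) ^ 2 / (d₂ ^ 2 + (β₁ - 1) ^ 2) + 2 * (β₁ + 1) ^ 2 / (d₂ ^ 2 + (β₁ + 1) ^ 2) - 1) ∧
    1 + 2 * β₂ * (β₂ - 1) / N₁ₗ + 2 * β₂ * (β₂ + 1) / N₂ₗ ≤ T₁ ∧ T₁ ≤ 10 ∧ 2 * d₂ / N₁ₗ + 2 * d₂ / N₂ₗ ≤ R₁ ∧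
    1 / 2 - 1 / (2 * β₂) - 2 * (β₁ - 1) / N₁ᵤ ≤ I₁ ∧ -I₁ ≤ 1 / 2 - 1 / (2 * β₁) - 2 * (β₂ - 1) / N₁ₗ ∧
    0 ≤ e₁ ∧ R₁ ^ 2 + I₁ ^ 2 ≤ e₁ ^ 2 ∧ 0 ≤ r₁ ∧ N₁ᵤ ≤ (r₁ * β₁) ^ 2 ∧
    2 / 3 ≤ e₁ + μ₀ * r₁ ∧ e₁ + μ₀ * r₁ ≤ 13 / 2 ∧ CellOK S₀ T₁ (e₁ + μ₀ * r₁) β₁ μ₀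

/-- ★ §6 THE RECTANGLE LEMMA, TABLE FORM: `RectData` + the rectangle's four coordinate bounds ⇒ `CellAt μ₀ v z`. -/
theorem cellAt_of_rectData (β₁ β₂ d₁ d₂ N₁ₗ N₁ᵤ N₂ₗ S₀ T₁ R₁ I₁ e₁ r₁ : ℝ) {μ₀ : ℝ} {v z : ℂ}
    (hd : RectData μ₀ β₁ β₂ d₁ d₂ N₁ₗ N₁ᵤ N₂ₗ S₀ T₁ R₁ I₁ e₁ r₁)
    (hv : 0 < v.im) (hvz : v.im < z.im) (ht : |v.re - z.re| ≤ v.im + z.im) (hsep : v.im ≤ 2 * ‖v - z‖)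
    (hb1 : β₁ * v.im ≤ z.im) (hb2 : z.im ≤ β₂ * v.im)
    (hdl : d₁ * v.im ≤ |z.re - v.re|) (hdu : |z.re - v.re| ≤ d₂ * v.im) : CellAt μ₀ v z := by
  obtain ⟨hβ1, hd1, hN1l, hN1l0, hN1u, hN2l, hN2l0, hS0, hS, hT, hT10, hR, hIu, hIl, he0, he, hr0, hr, hPlo,
    hPhi, hOK⟩ := hd
  exact cellAt_of_rect hv hvz ht hsep hβ1 hb1 hb2 hd1 hdl hdu hN1l hN1l0 hN1u hN2l hN2l0 hS0 hS hT hT10 hR hIu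
    hIl he0 he hr0 hr hPlo hPhi hOK

end RhW08.BudgetRect
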